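import Literature.AlgebraicGeometry.HodgeTheory.PolarizedLimitMixedHodgeStructureHodgeClassLimit
import Literature.AlgebraicGeometry.Motives.HodgeStructureHodgeNormLattice
import HarnessLib

/-!
# Integral classes of bounded Hodge norm near the puncture of a one-variable nilpotent orbit lie in `W_k`, and their top
# components take finitely many values (Cattani–Deligne–Kaplan, Thm. 2.5 (ii) first clause and Prop. 4.3/4.6, `n = 1`)

Topic `Literature/AlgebraicGeometry/HodgeTheory` (namespace `…HodgeTheory.PolarizedLimitMixedHodgeStructure`).  Theorems only; no
definition, no instance, no named fact (D-0026 net debt `0`).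

PRINTED SOURCE, VERBATIM. E. Cattani, P. Deligne, A. Kaplan, *On the locus of Hodge classes*, J. Amer. Math. Soc. 8 (1995) 483–506,
p. 488: **Theorem 2.5.** «Assume `𝒱` of weight `0`. Given `K`, there is a constant `A₁` (depending on `K` and `𝒱`) such that (i) There
are only finitely many `v ∈ V_ℤ` such that: `Q(v, v) ≤ K` and `v ∈ Φ⁰(z)` at some point `z` with `0 ≤ x_i ≤ 1` and `inf(y_i) ≥ A₁`.
(ii) Any such `v` is in `W₀` …»; p. 501: **Proposition 4.3.** «For `n` large enough, `u(n)` is in `W₀¹`.», proof (p. 503): «Fix a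
rational decomposition `V = ⊕ A^l` as in (3.7.1). The projection of `V_ℤ` in `A^l` is a lattice. By (3.9.1), it follows that if
`u(n)` has a nonzero projection in `A^a`, then `‖v(n)‖² ≫ τ₁(n)^{a₁}⋯`. … As `‖v(n)‖` is bounded, we conclude that `l₁ = … = l_d = 0`.»;
**4.6** (p. 503): «By 4.5 (ii), or directly by 3.9 (ii), `u(n)¹` is bounded. Being in a lattice, it can take only a finite number of
values.»

WHAT IS FORMALIZED — ONE VARIABLE, the nilpotent orbit `θ(z) = L.nilpotentOrbit z` of a polarized limit mixed Hodge structure `L` of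
weight `k` on a finite-dimensional `ℚ`-space `V` (the tree's `PolarizedLimitMixedHodgeStructureHodgeNormEstimates`: for `Im z > β`,
`½ (√Im z)^{m−k} |π̂_m exp(−(Re z)N) v|₀ ≤ ‖v‖_{θ(z)}`, `π̂_m` the projections of the `δ`-grading `V_ℂ = ⊕ Ê_m`, `|·|₀` the reference
norm), an INTEGRAL STRUCTURE `Λ ⊆ V` (any finitely generated subgroup), and the lattice facts of `Motives/HodgeStructureHodgeNormLattice`:
* §1 «the projection of `V_ℤ` in `A^l` is a lattice»: the top components `π̂_m (1 ⊗ u)`, `u ∈ Λ ∩ W_m`, are bounded below by a constant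
  `c > 0` when nonzero, uniformly in `m` (`exists_pos_forall_le_referenceNorm_deligneEProj`), and take finitely many values below any
  bound (`finite_image_deligneEProj_referenceNorm_le`) — `π̂_m|_{W_m}` has kernel `W_{m−1}`;
* §2 **CDK Thm. 2.5 (ii), first clause, `n = 1`, EFFECTIVE**: given `C` there is `A` such that every `u ∈ Λ` with `‖1 ⊗ u‖_{θ(z)} ≤ C` at
  some point with `Im z ≥ A` lies in `W_k` (`mem_W_of_hodgeNorm_ofRat_le`): if the top weight `m` of `u` exceeded `k`, then
  `c ≤ |π̂_m(1 ⊗ u)|₀ ≤ 2C/√Im z` (`π̂_m` of `exp(−xN)(1 ⊗ u)` is that of `1 ⊗ u`) — Prop. 4.3 at `d = 1`, with `A = (2C/c + 1)²`.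
  For HODGE CLASSES: `‖1 ⊗ u‖²_{θ(z)} = |Q(u, u)|` (`hodgeNorm_nilpotentOrbit_ofRat_sq_of_mem_piece`), so **every `u ∈ Λ` with `|Q(u,u)| ≤ K`
  of type `(p, k−p)` at a point with `Im z ≥ A₁(K)` lies in `W_k`** (`mem_W_of_abs_Q_le_of_ofRat_mem_nilpotentOrbit_piece`) — «any such `v`
  is in `W₀`», now for integral classes at a SINGLE point (the fixed-`v` form is the tree's `mem_baseChange_W_of_frequently_mem_piece`).
* §3 **Prop. 4.6 at `d = 1`**: for `u ∈ W_k` (rational or not) with `‖x‖_{θ(z)} ≤ C`, `Im z > β`: `|π̂_k x|₀ ≤ 2C`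
  (`referenceNorm_deligneEProj_self_le_of_hodgeNorm_le`); hence the top classes `π̂_k(1 ⊗ u)` of the `u ∈ Λ ∩ W_k` of Hodge norm `≤ C` at
  some far point form a FINITE set (`finite_image_deligneEProj_self_of_hodgeNorm_le`) — «`u(n)¹` is bounded. Being in a lattice, it can
  take only a finite number of values.»

NOT HERE: the invariance of the top class under `N` (CDK Prop. 4.7, the compactness step) and the finiteness of the classes `u`
themselves (Thm. 2.5 (i)) — sequel files; several variables.

## References

* [CattaniDeligneKaplan1995] E. Cattani, P. Deligne, A. Kaplan, *On the locus of Hodge classes*, J. Amer. Math. Soc. 8 (1995)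
  483–506: Thm. 2.5 (p. 488), (3.9.1) (p. 498), Prop. 4.3 and its proof, 4.6 (pp. 501–503).
* [Schmid1973] W. Schmid, Invent. Math. 22 (1973): Thm. (6.6), Cor. (6.7') (cite only).
* [CattaniKaplanSchmid1987] E. Cattani, A. Kaplan, W. Schmid, LNM 1246 (1987): §3 Cor. (3.7).
* [CarlsonMullerStachPeters2017] J. Carlson, S. Müller-Stach, C. Peters, *Period Mappings and Period Domains*, 2nd ed. (2017): §2.3
  Thm. 2.3.3 and eq. (2.6).
-/

noncomputable section

open scoped TensorProduct ComplexOrder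

namespace Literature.AlgebraicGeometry

open Module
open Motives Motives.MixedHodgeStructure Motives.HodgeStructure
open Motives.HodgeStructure (conj ofRat ofRat_apply conj_ofRat)

universe u

variable {V : Type u} [AddCommGroup V] [Module ℚ V] [FiniteDimensional ℚ V] {k : ℤ}

namespace HodgeTheory

namespace PolarizedLimitMixedHodgeStructure

variable (L : PolarizedLimitMixedHodgeStructure V k)

/-! ## §0 Tools -/

/-- The total weights `p + q` of the nonzero `Î^{p,q}` of the `δ`-splitting lie in a finite set. [folklore] -/
private theorem exists_weights_subset :
    ∃ s : Finset ℤ, ∀ p q : ℤ, L.deltaSplit.toMixedHodgeStructure.deligneI p q ≠ ⊥ → p + q ∈ s := by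
  classical
  refine ⟨L.deltaSplit.toMixedHodgeStructure.finite_setOf_deligneFamily_ne_bot.toFinset.image fun pq => pq.1 + pq.2,
    fun p q h => Finset.mem_image.2 ⟨(p, q), ?_, rfl⟩⟩
  rw [Set.Finite.mem_toFinset, Set.mem_setOf_eq, deligneFamily_apply]
  exact h

/-- `1 ⊗ u ∈ W_{m,ℂ} ↔ u ∈ W_m` (rationality of base-changed subspaces). [folklore] -/
private theorem ofRat_mem_baseChange_W_iff {m : ℤ} {u : V} : ofRat u ∈ (L.W m).baseChange ℂ ↔ u ∈ L.W m := by
  rw [ofRat_apply]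
  exact ⟨fun h => MixedHodgeStructure.mem_of_one_tmul_mem_baseChange _ h, fun h => Submodule.tmul_mem_baseChange_of_mem 1 h⟩

/-- **`‖1 ⊗ u‖²_{θ(z)} = |Q(u, u)|` for a rational class of type `(p, k−p)` at `θ(z)`** (the Hodge norm of a real class of pure type is
`|Q|`; `Q_ℂ(1 ⊗ u, 1 ⊗ u) = Q(u, u)`). [cite: CattaniDeligneKaplan1995, Remark 2.6 and 2.9 (pp. 488–491)] [cite: CarlsonMullerStachPeters2017, §2.3 Thm. 2.3.3 and eq. (2.6)] -/
theorem hodgeNorm_nilpotentOrbit_ofRat_sq_of_mem_piece {z : ℂ} (hz : L.orbitThreshold < z.im) {p : ℤ} {u : V}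
    (hu : ofRat u ∈ (L.nilpotentOrbit z hz).piece p (k - p)) :
    (L.nilpotentOrbitPolarization z hz).hodgeNorm (ofRat u) ^ 2 = |(L.Q u u : ℝ)| := by
  rw [L.hodgeNorm_nilpotentOrbit_sq_of_mem_piece_of_conj_eq hz hu (conj_ofRat u), ofRat_apply, LinearMap.BilinForm.baseChange_tmul,
    mul_one]
  rw [show ((L.Q u u : ℚ) : ℚ) • (1 : ℂ) = ((L.Q u u : ℚ) : ℝ) by rw [Rat.smul_one_eq_cast]; norm_cast, Complex.norm_real,
    Real.norm_eq_abs]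

/-- Hence `‖1 ⊗ u‖_{θ(z)} ≤ √K` when `|Q(u, u)| ≤ K` and `u` is of type `(p, k−p)` at `θ(z)`. [cite: CattaniDeligneKaplan1995, Remark 2.6 and 2.17 (iii)] -/
theorem hodgeNorm_nilpotentOrbit_ofRat_le_sqrt_of_mem_piece {z : ℂ} (hz : L.orbitThreshold < z.im) {p : ℤ} {u : V}
    (hu : ofRat u ∈ (L.nilpotentOrbit z hz).piece p (k - p)) {K : ℝ} (hK : |(L.Q u u : ℝ)| ≤ K) :
    (L.nilpotentOrbitPolarization z hz).hodgeNorm (ofRat u) ≤ Real.sqrt K := by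
  rw [← Real.sqrt_sq ((L.nilpotentOrbitPolarization z hz).hodgeNorm_nonneg _), L.hodgeNorm_nilpotentOrbit_ofRat_sq_of_mem_piece hz hu]
  exact Real.sqrt_le_sqrt hK

/-! ## §1 The top components of integral classes form a lattice: discreteness and finiteness of `π̂_m(1 ⊗ u)`, `u ∈ Λ ∩ W_m` -/

/-- **«The projection of `V_ℤ` in `A^l` is a lattice», weight by weight**: for `Λ ⊆ V` finitely generated and every `m` there is
`c > 0` with `|π̂_m (1 ⊗ u)|₀ ≥ c` for all `u ∈ Λ ∩ W_m` with `π̂_m(1 ⊗ u) ≠ 0` (`π̂_m` restricted to `W_{m,ℂ}` has kernel `W_{m−1,ℂ}`).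
[cite: CattaniDeligneKaplan1995, proof of Prop. 4.3 (p. 503) and (3.7.1)] -/
theorem exists_pos_forall_le_referenceNorm_deligneEProj_of_fg (Λ : Submodule ℤ V) (hΛ : Λ.FG) (m : ℤ) :
    ∃ c : ℝ, 0 < c ∧ ∀ u ∈ Λ, u ∈ L.W m → L.deltaSplit.toMixedHodgeStructure.deligneEProj m (ofRat u) ≠ 0 →
      c ≤ L.referenceNorm (L.deltaSplit.toMixedHodgeStructure.deligneEProj m (ofRat u)) := by
  obtain ⟨c, hc, h⟩ := (L.deltaSplit.sharpPolarization L.isSplitOverR_deltaSplit).exists_pos_forall_le_hodgeNorm_apply_of_fg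
    (A := L.W (m - 1)) (B := L.W m) (L.deltaSplit.toMixedHodgeStructure.deligneEProj m)
    (fun x hx => L.deltaSplit.toMixedHodgeStructure.deligneEProj_apply_eq_zero_of_mem_baseChange_W (show m - 1 < m by omega) hx)
    (fun x hx h0 => (L.deltaSplit.toMixedHodgeStructure.deligneEProj_apply_eq_zero_iff_of_mem_baseChange_W hx).1 h0) Λ hΛ
  refine ⟨c, hc, fun u hu huW hne => ?_⟩
  rw [L.referenceNorm_eq]
  exact h u hu huW hne

/-- **Uniform version**: one constant `c > 0` for all weights `m` (only finitely many `Ê_m` are nonzero).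
[cite: CattaniDeligneKaplan1995, proof of Prop. 4.3 (p. 503)] -/
theorem exists_pos_forall_forall_le_referenceNorm_deligneEProj_of_fg (Λ : Submodule ℤ V) (hΛ : Λ.FG) :
    ∃ c : ℝ, 0 < c ∧ ∀ (m : ℤ), ∀ u ∈ Λ, u ∈ L.W m → L.deltaSplit.toMixedHodgeStructure.deligneEProj m (ofRat u) ≠ 0 →
      c ≤ L.referenceNorm (L.deltaSplit.toMixedHodgeStructure.deligneEProj m (ofRat u)) := by
  classical
  obtain ⟨s, hs⟩ := L.exists_weights_subset
  choose c hc h using fun m => L.exists_pos_forall_le_referenceNorm_deligneEProj_of_fg Λ hΛ m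
  set s' : Finset ℤ := insert k s with hs'_def
  have hne : s'.Nonempty := ⟨k, Finset.mem_insert_self _ _⟩
  refine ⟨s'.inf' hne c, ?_, fun m u hu huW hne0 => ?_⟩
  · obtain ⟨m, hm, hmin⟩ := Finset.exists_mem_eq_inf' hne c
    rw [hmin]
    exact hc m
  · by_cases hm : m ∈ s'
    · exact (Finset.inf'_le c hm).trans (h m u hu huW hne0)
    · -- weights outside `s` carry nothing: `π̂_m = 0`
      exfalso
      apply hne0
      have hsum := L.deltaSplit.toMixedHodgeStructure.sum_deligneEProj_apply s hs (ofRat u)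
      conv_lhs => rw [← hsum]
      rw [map_sum]
      refine Finset.sum_eq_zero fun m' hm' => ?_
      rw [L.deltaSplit.toMixedHodgeStructure.deligneEProj_deligneEProj_apply]
      exact if_neg fun h : m' = m => hm (h ▸ Finset.mem_insert_of_mem hm')

/-- **«Being in a lattice, it can take only a finite number of values»**: for every weight `m` and bound `R`, the set of top
components `{π̂_m(1 ⊗ u) : u ∈ Λ ∩ W_m, |π̂_m(1 ⊗ u)|₀ ≤ R}` is finite. [cite: CattaniDeligneKaplan1995, 4.6 (p. 503)] -/
theorem finite_image_deligneEProj_referenceNorm_le_of_fg (Λ : Submodule ℤ V) (hΛ : Λ.FG) (m : ℤ) (R : ℝ) :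
    {x : ℂ ⊗[ℚ] V | ∃ u ∈ Λ, u ∈ L.W m ∧ L.referenceNorm (L.deltaSplit.toMixedHodgeStructure.deligneEProj m (ofRat u)) ≤ R ∧
      L.deltaSplit.toMixedHodgeStructure.deligneEProj m (ofRat u) = x}.Finite := by
  have h := (L.deltaSplit.sharpPolarization L.isSplitOverR_deltaSplit).finite_image_hodgeNorm_apply_le_of_fg
    (A := L.W (m - 1)) (B := L.W m) (L.deltaSplit.toMixedHodgeStructure.deligneEProj m)
    (fun x hx => L.deltaSplit.toMixedHodgeStructure.deligneEProj_apply_eq_zero_of_mem_baseChange_W (show m - 1 < m by omega) hx)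
    (fun x hx h0 => (L.deltaSplit.toMixedHodgeStructure.deligneEProj_apply_eq_zero_iff_of_mem_baseChange_W hx).1 h0) Λ hΛ R
  refine h.subset ?_
  rintro x ⟨u, hu, huW, hR, rfl⟩
  refine ⟨u, hu, huW, ?_, rfl⟩
  rwa [L.referenceNorm_eq] at hR

/-! ## §2 CDK Thm. 2.5 (ii), first clause, for integral classes at a single far point: bounded Hodge norm ⟹ `u ∈ W_k` -/

/-- **CDK Prop. 4.3 at `d = 1`, effective: given `C`, there is `A` such that every `u ∈ Λ` with `‖1 ⊗ u‖_{θ(z)} ≤ C` at some point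
`θ(z)` with `Im z ≥ A` (`Im z > β`, any `Re z`) lies in `W_k`.**  Proof: if the top weight `m` of `u` were `> k`, then
`c ≤ |π̂_m(1 ⊗ u)|₀ = |π̂_m(exp(−(Re z)N)(1 ⊗ u))|₀ ≤ 2C/(√Im z)^{m−k} ≤ 2C/√Im z`, impossible for `√Im z > 2C/c`.
[cite: CattaniDeligneKaplan1995, Thm. 2.5 (ii) (p. 488) and Prop. 4.3 with proof (pp. 501–503)] [cite: Schmid1973, Thm. (6.6) (cite only)] -/
theorem exists_forall_mem_W_of_hodgeNorm_ofRat_le (Λ : Submodule ℤ V) (hΛ : Λ.FG) (C : ℝ) :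
    ∃ A : ℝ, ∀ u ∈ Λ, ∀ (z : ℂ) (hz : L.normThreshold < z.im), A ≤ z.im →
      (L.nilpotentOrbitPolarization z (L.orbitThreshold_lt_im hz)).hodgeNorm (ofRat u) ≤ C → u ∈ L.W k := by
  classical
  obtain ⟨s, hs⟩ := L.exists_weights_subset
  obtain ⟨c, hc, hcle⟩ := L.exists_pos_forall_forall_le_referenceNorm_deligneEProj_of_fg Λ hΛ
  refine ⟨max 1 ((2 * C / c + 1) ^ 2), fun u hu z hz hAz hC => ?_⟩
  by_contra huW
  -- the top nonzero component `m₀ > k` of `x = 1 ⊗ u`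
  set x : ℂ ⊗[ℚ] V := ofRat u with hx_def
  have hxW : x ∉ (L.W k).baseChange ℂ := fun h => huW (L.ofRat_mem_baseChange_W_iff.1 h)
  set T : Finset ℤ := s.filter fun m => L.deltaSplit.toMixedHodgeStructure.deligneEProj m x ≠ 0 with hT_def
  have hT : T.Nonempty := by
    by_contra hT
    rw [Finset.not_nonempty_iff_eq_empty] at hT
    apply hxW
    refine L.deltaSplit.toMixedHodgeStructure.mem_baseChange_W_of_forall_deligneEProj_eq_zero s hs fun m hm _ => ?_
    by_contra hne
    have : m ∈ T := Finset.mem_filter.2 ⟨hm, hne⟩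
    rw [hT] at this
    exact Finset.notMem_empty _ this
  set m₀ := T.max' hT with hm₀_def
  have hm₀T : m₀ ∈ T := Finset.max'_mem T hT
  have hm₀ne : L.deltaSplit.toMixedHodgeStructure.deligneEProj m₀ x ≠ 0 := (Finset.mem_filter.1 hm₀T).2
  have hxWm : x ∈ (L.W m₀).baseChange ℂ := by
    refine L.deltaSplit.toMixedHodgeStructure.mem_baseChange_W_of_forall_deligneEProj_eq_zero s hs fun m hm hlt => ?_
    by_contra hne
    exact not_lt.2 (T.le_max' m (Finset.mem_filter.2 ⟨hm, hne⟩)) hlt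
  have hkm₀ : k < m₀ := by
    by_contra hle
    exact hxW (Submodule.baseChange_mono ℂ (L.monotone_W (not_lt.1 hle)) hxWm)
  have huWm : u ∈ L.W m₀ := L.ofRat_mem_baseChange_W_iff.1 hxWm
  -- lattice: `c ≤ |π̂_{m₀} x|₀`
  have hlow : c ≤ L.referenceNorm (L.deltaSplit.toMixedHodgeStructure.deligneEProj m₀ x) := hcle m₀ u hu huWm hm₀ne
  -- estimate: `|π̂_{m₀} x|₀ = |π̂_{m₀} (exp(-xN) x)|₀ ≤ 2C/(√y)^{m₀-k}`
  set w := IsNilpotent.exp (-((z.re : ℂ) • L.N.baseChange ℂ)) x with hw_def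
  have hxw : IsNilpotent.exp ((z.re : ℂ) • L.N.baseChange ℂ) w = x := by
    rw [hw_def, ← Module.End.mul_apply, IsNilpotent.exp_mul_exp_neg_self (L.isNilpotent_N_baseChange.smul _), Module.End.one_apply]
  have hproj : L.deltaSplit.toMixedHodgeStructure.deligneEProj m₀ w = L.deltaSplit.toMixedHodgeStructure.deligneEProj m₀ x := by
    have e : -((z.re : ℂ) • L.N.baseChange ℂ) = (-(z.re : ℂ)) • L.N.baseChange ℂ := (neg_smul _ _).symm
    rw [hw_def, e]
    exact L.deligneEProj_exp_smul_N_apply_of_mem_baseChange_W _ hxWm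
  rw [← hxw] at hC
  have hb := L.referenceNorm_deligneEProj_le_of_hodgeNorm_le hz hC m₀
  rw [hproj] at hb
  -- arithmetic
  have hy1 : 1 ≤ z.im := (le_max_left _ _).trans hAz
  have ht1 : 1 ≤ Real.sqrt z.im := by rw [← Real.sqrt_one]; exact Real.sqrt_le_sqrt hy1
  have ht : 2 * C / c + 1 ≤ Real.sqrt z.im := by
    by_cases hneg : 2 * C / c + 1 ≤ 0
    · exact hneg.trans (Real.sqrt_nonneg _)
    · rw [← Real.sqrt_sq (le_of_lt (not_le.1 hneg))]
      exact Real.sqrt_le_sqrt ((le_max_right _ _).trans hAz)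
  have hpos : 0 < Real.sqrt z.im := one_pos.trans_le ht1
  have hpow : Real.sqrt z.im ≤ Real.sqrt z.im ^ (m₀ - k) := by
    calc Real.sqrt z.im = Real.sqrt z.im ^ (1 : ℤ) := (zpow_one _).symm
      _ ≤ Real.sqrt z.im ^ (m₀ - k) := zpow_le_zpow_right₀ ht1 (by omega)
  by_cases hC0 : 0 ≤ C
  · have h2 : c ≤ 2 * C / Real.sqrt z.im :=
      hlow.trans (hb.trans (div_le_div_of_nonneg_left (by positivity) hpos hpow))
    rw [le_div_iff₀ hpos] at h2
    have h3 : (2 * C / c + 1) * c ≤ Real.sqrt z.im * c := mul_le_mul_of_nonneg_right ht hc.le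
    have h4 : (2 * C / c + 1) * c = 2 * C + c := by field_simp
    nlinarith
  · have : c ≤ 0 := hlow.trans (hb.trans (div_nonpos_of_nonpos_of_nonneg (by linarith) (zpow_pos hpos _).le))
    linarith

/-- **CDK Thm. 2.5 (ii), first clause, `n = 1`, for integral classes: given `K`, there is `A₁` such that every `u ∈ Λ` with
`|Q(u, u)| ≤ K` which is of type `(p, k−p)` at some point `θ(z)` with `Im z ≥ A₁` lies in `W_k`** — «any such `v` is in `W₀`».
[cite: CattaniDeligneKaplan1995, Thm. 2.5 (ii) (p. 488) and Prop. 4.3 (p. 501)] [cite: Schmid1973, Thm. (6.6) (cite only)] -/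
theorem exists_forall_mem_W_of_ofRat_mem_nilpotentOrbit_piece (Λ : Submodule ℤ V) (hΛ : Λ.FG) (K : ℝ) (p : ℤ) :
    ∃ A₁ : ℝ, L.normThreshold < A₁ ∧ ∀ u ∈ Λ, |(L.Q u u : ℝ)| ≤ K → ∀ (z : ℂ) (hz : L.normThreshold < z.im), A₁ ≤ z.im →
      ofRat u ∈ (L.nilpotentOrbit z (L.orbitThreshold_lt_im hz)).piece p (k - p) → u ∈ L.W k := by
  obtain ⟨A, hA⟩ := L.exists_forall_mem_W_of_hodgeNorm_ofRat_le Λ hΛ (Real.sqrt K)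
  refine ⟨max A (L.normThreshold + 1), lt_of_lt_of_le (lt_add_one _) (le_max_right _ _), fun u hu hK z hz hAz hup => ?_⟩
  exact hA u hu z hz ((le_max_left _ _).trans hAz) (L.hodgeNorm_nilpotentOrbit_ofRat_le_sqrt_of_mem_piece _ hup hK)

/-! ## §3 The top class `π̂_k x` is bounded, and for integral classes takes finitely many values (CDK 4.6, `d = 1`) -/

/-- **`|π̂_k x|₀ ≤ 2C` for `x ∈ W_{k,ℂ}` with `‖x‖_{θ(z)} ≤ C`, `Im z > β`** — the weight-`k` component of a class of weight `≤ k` of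
bounded Hodge norm is bounded in the reference norm, uniformly in the point (`π̂_k (exp(−(Re z)N) x) = π̂_k x` and
`½|π̂_k ·|₀ ≤ ‖exp((Re z)N) ·‖_{θ(z)}`): «`u(n)¹` is bounded». [cite: CattaniDeligneKaplan1995, 4.6 and Lemma 4.5 (ii) (pp. 502–503)]
[cite: CattaniKaplanSchmid1987, §3 Cor. (3.7)] -/
theorem referenceNorm_deligneEProj_self_le_of_hodgeNorm_le {z : ℂ} (hz : L.normThreshold < z.im) {C : ℝ} {x : ℂ ⊗[ℚ] V}
    (hxW : x ∈ (L.W k).baseChange ℂ) (hC : (L.nilpotentOrbitPolarization z (L.orbitThreshold_lt_im hz)).hodgeNorm x ≤ C) :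
    L.referenceNorm (L.deltaSplit.toMixedHodgeStructure.deligneEProj k x) ≤ 2 * C := by
  set w := IsNilpotent.exp (-((z.re : ℂ) • L.N.baseChange ℂ)) x with hw_def
  have hxw : IsNilpotent.exp ((z.re : ℂ) • L.N.baseChange ℂ) w = x := by
    rw [hw_def, ← Module.End.mul_apply, IsNilpotent.exp_mul_exp_neg_self (L.isNilpotent_N_baseChange.smul _), Module.End.one_apply]
  have hproj : L.deltaSplit.toMixedHodgeStructure.deligneEProj k w = L.deltaSplit.toMixedHodgeStructure.deligneEProj k x := by
    have e : -((z.re : ℂ) • L.N.baseChange ℂ) = (-(z.re : ℂ)) • L.N.baseChange ℂ := (neg_smul _ _).symm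
    rw [hw_def, e]
    exact L.deligneEProj_exp_smul_N_apply_of_mem_baseChange_W _ hxW
  rw [← hxw] at hC
  have hb := L.referenceNorm_deligneEProj_le_of_hodgeNorm_le hz hC k
  rwa [hproj, sub_self, zpow_zero, div_one] at hb

/-- **CDK 4.6 at `d = 1`: the top classes `π̂_k(1 ⊗ u)` of the integral classes `u ∈ Λ ∩ W_k` of Hodge norm `≤ C` at some point with
`Im z > β` form a finite set** — «`u(n)¹` is bounded. Being in a lattice, it can take only a finite number of values.»
[cite: CattaniDeligneKaplan1995, 4.6 (p. 503)] [cite: Schmid1973, Thm. (6.6) (cite only)] -/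
theorem finite_image_deligneEProj_self_of_hodgeNorm_le (Λ : Submodule ℤ V) (hΛ : Λ.FG) (C : ℝ) :
    {x : ℂ ⊗[ℚ] V | ∃ u ∈ Λ, u ∈ L.W k ∧ (∃ (z : ℂ) (hz : L.normThreshold < z.im),
      (L.nilpotentOrbitPolarization z (L.orbitThreshold_lt_im hz)).hodgeNorm (ofRat u) ≤ C) ∧
      L.deltaSplit.toMixedHodgeStructure.deligneEProj k (ofRat u) = x}.Finite := by
  refine (L.finite_image_deligneEProj_referenceNorm_le_of_fg Λ hΛ k (2 * C)).subset ?_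
  rintro x ⟨u, hu, huW, ⟨z, hz, hC⟩, rfl⟩
  exact ⟨u, hu, huW, L.referenceNorm_deligneEProj_self_le_of_hodgeNorm_le hz (L.ofRat_mem_baseChange_W_iff.2 huW) hC, rfl⟩

/-- The same for HODGE CLASSES with `|Q(u, u)| ≤ K`: the top classes `π̂_k(1 ⊗ u)` of the `u ∈ Λ ∩ W_k` which are of type `(p, k−p)` at
some point with `Im z > β` and have `|Q(u,u)| ≤ K` form a finite set. [cite: CattaniDeligneKaplan1995, Thm. 2.5 and 4.6 (pp. 488, 503)] -/
theorem finite_image_deligneEProj_self_of_ofRat_mem_nilpotentOrbit_piece (Λ : Submodule ℤ V) (hΛ : Λ.FG) (K : ℝ) (p : ℤ) :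
    {x : ℂ ⊗[ℚ] V | ∃ u ∈ Λ, u ∈ L.W k ∧ |(L.Q u u : ℝ)| ≤ K ∧ (∃ (z : ℂ) (hz : L.normThreshold < z.im),
      ofRat u ∈ (L.nilpotentOrbit z (L.orbitThreshold_lt_im hz)).piece p (k - p)) ∧
      L.deltaSplit.toMixedHodgeStructure.deligneEProj k (ofRat u) = x}.Finite := by
  refine (L.finite_image_deligneEProj_self_of_hodgeNorm_le Λ hΛ (Real.sqrt K)).subset ?_
  rintro x ⟨u, hu, huW, hK, ⟨z, hz, hup⟩, rfl⟩
  exact ⟨u, hu, huW, ⟨z, hz, L.hodgeNorm_nilpotentOrbit_ofRat_le_sqrt_of_mem_piece _ hup hK⟩, rfl⟩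

end PolarizedLimitMixedHodgeStructure

end HodgeTheory

end Literature.AlgebraicGeometry

end
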